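import Literature.NumberTheory.Weil1964.ArchFollandTorusAdelic
import HarnessLib

/-!
# The maximal compact of `U(T)(ℂ/ℝ)` in adapted Folland coordinates (STEP 1–2 beyond the torus)

Topic `NumberTheory/Weil1964`; namespace `Literature.NumberTheory.Weil1964`. Definitions and proved lemmas only
(finite-dimensional linear algebra over `ℝ`/`ℂ` plus the adelic frame bookkeeping of `ArchFollandTorusAdelic`):
**no named facts, no records, 0 proof holes**.

**Setting** (as in `ArchFollandTorus` / `ArchFollandTorusAdelic`).  Purely imaginary quadratic coordinates
`IsQuadraticCoordinates Complex.ofRealHom Ψ δ' d` (`δ'.re = 0`, `m := δ'.im ≠ 0`), a real diagonal Gram matrix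
`T = diag(t)`, the restriction-of-scalars action `resAut : GLₙ(ℂ) →* (ℝⁿ × ℝⁿ ≃ₗ ℝⁿ × ℝⁿ)`, the adapted Folland scaling
`follandScale D t (a, b) = (D a, -D⁻¹ T b)` with `m · D_j² = ε_j · t_j`, `ε_j = ±1`, and the phase-space currency
`realify U (p, q) = (re U(p + iq), im U(p + iq))` of `Analysis/SegalBargmann`.  STEP 1 (`follandScale_resAut_torusGL`)
computed the compact diagonal TORUS `diag(e^{iθ})` in these coordinates.  This file does the same for the WHOLE compact
group that the torus sits in: every `k ∈ GLₙ(ℂ)` which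

* preserves the hermitian form `diag(t)` (`k ∈ unitaryGroupOfForm conj (diag t)`, i.e. `k̄ᵀ diag(t) k = diag(t)`), and
* is SIGN-BLOCK: `k i j = 0` whenever `ε_i ≠ ε_j` (for `m > 0`: block-diagonal for the signature partition of `diag(t)`,
  the shape of the maximal compact `U(T₊) × U(T₋)` in a `T`-orthogonal frame, and of `(U(V₊) × U(V₋)) ⊗ 1` on `V ⊗ W`).

* §1 `signConj ε i` (complex conjugation on the coordinates with `ε_i = 1`, identity on those with `ε_i = -1`) and the
  **Folland unitary** `follandUnitaryMatrix D ε k`, entries `(D_i / D_j) · signConj ε i (k i j)`; under the two hypotheses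
  above and adaptedness it is a UNITARY matrix (`follandUnitaryMatrix_mem_unitaryGroup`), packaged as
  `follandUnitary … : Matrix.unitaryGroup n ℂ`.
* §2 the main computation **`follandScale_resAut_eq_realify_follandUnitary`**:
  `follandScale D t (resAut k (a, b)) = realify (follandUnitary …) (follandScale D t (a, b))` — in adapted Folland
  coordinates `k` IS the unitary `follandUnitary k ∈ U(n) = Sp ∩ O(2n)` (Folland Prop. (4.6)); on the torus
  `k = diag(e^{iθ})` the Folland unitary is STEP 1's `diagHom (torusPt (ε · θ))` (`follandUnitary_torusGL`).
* §3 the adelic form over a totally real `F` (frame `scaledFrame F ι D`, Gram matrix `T = diag(t₀) ⊗ 1`): under a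
  place-by-place hypothesis `hg` of the shape of STEP 2's (`g` acts at the real place `v` as `resAut (k v)`),
  **`archFolland_archAct_compact`** / **`archPhaseMap_compact`**:
  `archPhaseMap T e_D hTu g = realify (placeBlock (fun v => follandUnitary (k v)))`, the block-diagonal unitary over the
  real places; `_sqrt` form with the canonical scaling `D_{j,v} = √(|σ_v(t₀ j)| / |im δ'_v|)`,
  `ε_{j,v} = sgn(im δ'_v · σ_v(t₀ j))`.
* §4 the same in the CM currency of `archLocalToSymplectic` (`E/F` CM-type quadratic, `c`, `δ`, `wOf v`), the
  hypothesis `hg` literally over `UnitaryGroup.archLocalToSymplectic (wOf v) (k v)` with `k v ∈ archLocal E N J (wOf v)`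
  (form-preservation is then automatic, `archLocalForm_eq_map`): **`archPhaseMap_archLocalCompact`**.

Use (pub-hodgecm model cell, HAZARD γ-K (b) / D5-arch STEP 3 (d)): combined with `arch_covariant_rhoSD_exact`
(`ArchFollandCocycleOne`) and the compact rigidity of `Analysis/SegalBargmann` (`IsRhoCovariantS.toL2_apply`,
`toL2_unitaryOpPi`), the archimedean factor of an implementer of such `g` is `vacuum coefficient • unitaryOpPi
(follandUnitary)` — so the FULL maximal compact `K_∞` (not only its torus) acts on the Hermite / Fock-polynomial vectors
of the adapted frame through the explicit unitary `follandUnitary`, which is what a `κ`-ISOTYPY statement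
(`UnitaryGroup.kappaIsotypic`) needs.  That consequence is a separate file.

Dictionary with print: Folland [Folland1989] Ch. 4 §1, Prop. (4.6) p. 151: under `ℝ^{2n} = ℂⁿ`, `(p, q) ↔ p + iq`,
`Sp(n, ℝ) ∩ O(2n) = U(n)`; `realify` is that identification on matrices.  The unitary group of a hermitian space over
`ℂ/ℝ` sits in the symplectic group of the underlying real space (Mœglin–Vignéras–Waldspurger Ch. 1 I.17; tree
`toSymplectic` / `archLocalToSymplectic`), and its maximal compact subgroups are the stabilisers of the splittings into
definite subspaces, `U(T₊) × U(T₋)` for a diagonal `T` (Helgason Ch. X §6 Table V type A III; used here only as the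
motivation for the sign-block hypothesis — nothing about maximality is claimed or needed).

## Mathlib / tree

Mathlib: `Matrix.mem_unitaryGroup_iff'`, `Matrix.star_eq_conjTranspose`, `Matrix.conjTranspose_apply`,
`Matrix.mul_apply`, `Matrix.one_apply`, `Matrix.blockDiagonal` (`blockDiagonal_apply`, `blockDiagonal_mul`,
`blockDiagonal_conjTranspose`, `blockDiagonal_one`), `Matrix.mulVec`, `dotProduct`, `Fintype.sum_prod_type'`,
`Complex.ext_iff`, `Complex.conj_re/conj_im`, `Real.sqrt_ne_zero'`, `SignType.sign`.
Tree: STEP 1 `follandScale` (`follandScale_apply`), `torusGL` (`coe_torusGL`), `adapted_sqrt`, `sign_eq_one_or`,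
`im_ne_zero_of_isQuadraticCoordinates`, `re_eq_re`, `im_eq_im_div`, `UnitaryGroup.IsQuadraticCoordinates.resAut`
(`resAut_reIm`), `QuadraticCoordinates.reIm`, `unitaryGroupOfForm` (`mem_unitaryGroupOfForm_iff`); STEP 2
`placeVec`, `scaledFrame`, `archFolland_scaledFrame`, `archMat_diagonal`, `sqrt_scale_ne_zero`,
`realPlaceMap_eq_embedding_of_isReal`, `sqrt_scale_ne_zero_CM`; `archFolland` (`archFolland_bijective`,
`archPhaseMap_archFolland`), `archAct`, `SegalBargmann.realify`, `phasePt` (`phasePt_apply`), `diagHom` (`coe_diagHom`),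
`torusPt`; `UnitaryGroup.archLocal`, `archLocalToSymplectic`, `archLocalForm_eq_map`, `isQuadraticCoordinates_complex`,
`realPlaceMap`, `re_embedding_delta`, `im_embedding_delta_ne_zero`.

## References
* [Folland1989] G. B. Folland, *Harmonic Analysis in Phase Space*, Princeton UP (1989), Ch. 4 §1, Prop. (4.6) p. 151;
  Prop. (4.39).
* [MoeglinVignerasWaldspurger1987] C. Mœglin, M.-F. Vignéras, J.-L. Waldspurger, *Correspondances de Howe sur un corps
  p-adique*, LNM 1291 (1987), Ch. 1 I.17.

## Provenance

Written under the LEAN-IN-TREE rule (2026-08-18) for the pub-hodgecm formalisation cell (HAZARD γ-K (b) / D5-arch,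
STEP 3 (d) "the maximal compact through the adelic Folland coordinates", binder-2 lane gen 4).  KERNEL only — the
Fock-side consequences (`κ`-isotypy of the printed vectors) are a separate file.  Nothing here is a claim of the
sources beyond the cited dictionary; all statements are proved.
-/

set_option autoImplicit false

noncomputable section

open scoped Matrix Real Classical ComplexConjugate
open Complex NumberField NumberField.InfinitePlace NumberField.mixedEmbedding IsDedekindDomain
open Literature.NumberTheory.Automorphic Literature.NumberTheory.Automorphic.UnitaryGroup
open Literature.RepresentationTheory.HeisenbergGroup Literature.Analysis.SegalBargmann

namespace Literature.NumberTheory.Weil1964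

/-! ## §1 Sign conjugation and the Folland unitary of a sign-block form-preserving matrix -/

section SignConj

variable {n : Type*}

/-- **Sign conjugation**: complex conjugation on the coordinates with `ε_i = 1`, the identity on the others.
(In adapted Folland coordinates `ζ_j = D_j (a_j − i ε_j m b_j)` is `D_j x̄_j` or `D_j x_j` for `x_j = a_j + i m b_j`.)
[cite: Folland1989, Ch. 4 §1, Prop. (4.6) p. 151] -/
def signConj (ε : n → ℝ) (i : n) (z : ℂ) : ℂ := if ε i = 1 then conj z else z

/-- `signConj` on a `+1` coordinate is conjugation. [folklore] -/
theorem signConj_of_eq_one {ε : n → ℝ} {i : n} (h : ε i = 1) (z : ℂ) : signConj ε i z = conj z := if_pos h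

/-- `signConj` on a coordinate with `ε_i ≠ 1` is the identity. [folklore] -/
theorem signConj_of_ne_one {ε : n → ℝ} {i : n} (h : ε i ≠ 1) (z : ℂ) : signConj ε i z = z := if_neg h

/-- `signConj ε i 0 = 0`. [folklore] -/
@[simp] theorem signConj_zero (ε : n → ℝ) (i : n) : signConj ε i 0 = 0 := by
  unfold signConj; split_ifs <;> simp

/-- `signConj ε i` is additive. [folklore] -/
theorem signConj_add (ε : n → ℝ) (i : n) (z w : ℂ) : signConj ε i (z + w) = signConj ε i z + signConj ε i w := by
  unfold signConj; split_ifs <;> simp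

/-- `signConj ε i` is multiplicative. [folklore] -/
theorem signConj_mul (ε : n → ℝ) (i : n) (z w : ℂ) : signConj ε i (z * w) = signConj ε i z * signConj ε i w := by
  unfold signConj; split_ifs <;> simp

/-- `signConj ε i` commutes with finite sums. [folklore] -/
theorem signConj_sum (ε : n → ℝ) (i : n) {ι' : Type*} (s : Finset ι') (f : ι' → ℂ) :
    signConj ε i (∑ l ∈ s, f l) = ∑ l ∈ s, signConj ε i (f l) := by
  unfold signConj; split_ifs <;> simp [map_sum]

/-- `signConj ε i` fixes real numbers. [folklore] -/
@[simp] theorem signConj_ofReal (ε : n → ℝ) (i : n) (r : ℝ) : signConj ε i (r : ℂ) = r := by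
  unfold signConj; split_ifs <;> simp [Complex.conj_ofReal]

/-- `signConj ε i` is an involution. [folklore] -/
@[simp] theorem signConj_signConj (ε : n → ℝ) (i : n) (z : ℂ) : signConj ε i (signConj ε i z) = z := by
  unfold signConj; split_ifs <;> simp

/-- `signConj` commutes with conjugation. [folklore] -/
theorem conj_signConj (ε : n → ℝ) (i : n) (z : ℂ) : conj (signConj ε i z) = signConj ε i (conj z) := by
  unfold signConj; split_ifs <;> simp

/-- The real part is unchanged by `signConj`. [folklore] -/
@[simp] theorem re_signConj (ε : n → ℝ) (i : n) (z : ℂ) : (signConj ε i z).re = z.re := by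
  unfold signConj; split_ifs <;> simp

/-- The imaginary part changes by the sign `-ε_i` (for `ε_i = ±1`). [folklore] -/
theorem im_signConj {ε : n → ℝ} {i : n} (hε : ε i = 1 ∨ ε i = -1) (z : ℂ) :
    (signConj ε i z).im = -ε i * z.im := by
  unfold signConj
  rcases hε with h | h
  · rw [if_pos h, h, Complex.conj_im]; ring
  · rw [if_neg (by rw [h]; norm_num), h]; ring

/-- `conj (signConj ε i z) * signConj ε i w = signConj ε i (conj z * w)`. [folklore] -/
theorem conj_signConj_mul_signConj (ε : n → ℝ) (i : n) (z w : ℂ) :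
    conj (signConj ε i z) * signConj ε i w = signConj ε i (conj z * w) := by
  rw [conj_signConj, ← signConj_mul]

/-- Two coordinates of the same sign conjugate alike. [folklore] -/
theorem signConj_congr {ε : n → ℝ} {i j : n} (h : ε i = ε j) (z : ℂ) : signConj ε i z = signConj ε j z := by
  unfold signConj; rw [h]

end SignConj

section Unitary

variable {n : Type*} [Fintype n] [DecidableEq n]

/-- **Sign-block matrices**: `k i j = 0` whenever `ε_i ≠ ε_j` (block-diagonal for the partition of the index set by
the sign vector `ε`). [folklore] -/
def IsSignBlock (ε : n → ℝ) (k : Matrix n n ℂ) : Prop := ∀ i j, ε i ≠ ε j → k i j = 0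

omit [Fintype n] [DecidableEq n] in
/-- A sign-block matrix entry `k l i ≠ 0` forces `ε_l = ε_i`. [folklore] -/
theorem IsSignBlock.eq_of_ne_zero {ε : n → ℝ} {k : Matrix n n ℂ} (hk : IsSignBlock ε k) {l i : n}
    (h : k l i ≠ 0) : ε l = ε i := by
  by_contra hne; exact h (hk l i hne)

omit [Fintype n] in
/-- Diagonal matrices are sign-block for every sign vector. [folklore] -/
theorem isSignBlock_diagonal (ε : n → ℝ) (c : n → ℂ) : IsSignBlock ε (Matrix.diagonal c) :=
  fun i j hij => Matrix.diagonal_apply_ne c fun h => hij (by rw [h])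

/-- **The Folland unitary matrix** of `k` for the scaling `D` and the sign vector `ε`: entries
`(D_i / D_j) · signConj ε i (k i j)`. [cite: Folland1989, Ch. 4 §1, Prop. (4.6) p. 151] -/
def follandUnitaryMatrix (D ε : n → ℝ) (k : Matrix n n ℂ) : Matrix n n ℂ :=
  Matrix.of fun i j => ((D i / D j : ℝ) : ℂ) * signConj ε i (k i j)

omit [Fintype n] [DecidableEq n] in
/-- Entries of the Folland unitary matrix. [folklore] -/
@[simp] theorem follandUnitaryMatrix_apply (D ε : n → ℝ) (k : Matrix n n ℂ) (i j : n) :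
    follandUnitaryMatrix D ε k i j = ((D i / D j : ℝ) : ℂ) * signConj ε i (k i j) := rfl

/-- **From form-preservation to the `D²`-identity.**  If `k̄ᵀ diag(t) k = diag(t)` (membership in
`unitaryGroupOfForm conj (diag t)`), `k` is sign-block and the scaling is adapted (`m D_j² = ε_j t_j`, `ε_j = ±1`,
`m ≠ 0`), then `Σ_l conj(k l i) D_l² k l j = δ_ij D_i²`. [folklore] -/
theorem sum_conj_mul_sq_mul_eq {m : ℝ} (hm : m ≠ 0) {t D ε : n → ℝ} (hD : ∀ j, m * D j ^ 2 = ε j * t j)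
    (hε : ∀ j, ε j = 1 ∨ ε j = -1) (k : GL n ℂ)
    (hform : k ∈ unitaryGroupOfForm (starRingEnd ℂ) ((Matrix.diagonal t).map Complex.ofRealHom))
    (hblock : IsSignBlock ε (k : Matrix n n ℂ)) (i j : n) :
    ∑ l, conj ((k : Matrix n n ℂ) l i) * ((D l ^ 2 : ℝ) : ℂ) * (k : Matrix n n ℂ) l j =
      if i = j then ((D i ^ 2 : ℝ) : ℂ) else 0 := by
  have ht : ∀ l, t l = ε l * (m * D l ^ 2) := fun l => by
    rw [hD l]; rcases hε l with h | h <;> rw [h] <;> ring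
  have hij := congrFun (congrFun (mem_unitaryGroupOfForm_iff.mp hform) i) j
  rw [Matrix.diagonal_map (map_zero _), Matrix.mul_apply] at hij
  -- `hij : Σ_l ((k̄ᵀ * diag t) i l) * k l j = diag t i j`
  have hlhs : ∀ l, (((k : Matrix n n ℂ).map (starRingEnd ℂ))ᵀ * Matrix.diagonal fun j => Complex.ofRealHom (t j)) i l
      * (k : Matrix n n ℂ) l j = ((ε i * m : ℝ) : ℂ) *
        (conj ((k : Matrix n n ℂ) l i) * ((D l ^ 2 : ℝ) : ℂ) * (k : Matrix n n ℂ) l j) := by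
    intro l
    rw [Matrix.mul_diagonal, Matrix.transpose_apply, Matrix.map_apply]
    by_cases h0 : (k : Matrix n n ℂ) l i = 0
    · simp [h0]
    · have hεl : ε l = ε i := hblock.eq_of_ne_zero h0
      change conj ((k : Matrix n n ℂ) l i) * ((t l : ℝ) : ℂ) * (k : Matrix n n ℂ) l j = _
      rw [ht l, hεl]; push_cast; ring
  simp only [hlhs, ← Finset.mul_sum] at hij
  have hεm : ((ε i * m : ℝ) : ℂ) ≠ 0 := by
    rw [Complex.ofReal_ne_zero]
    exact mul_ne_zero (by rcases hε i with h | h <;> rw [h] <;> norm_num) hm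
  by_cases h : i = j
  · subst h
    rw [Matrix.diagonal_apply_eq] at hij
    change _ = ((t i : ℝ) : ℂ) at hij
    rw [ht i, show (((ε i * (m * D i ^ 2) : ℝ)) : ℂ) = ((ε i * m : ℝ) : ℂ) * ((D i ^ 2 : ℝ) : ℂ) by
      push_cast; ring] at hij
    rw [if_pos rfl]
    exact mul_left_cancel₀ hεm hij
  · rw [Matrix.diagonal_apply_ne _ h] at hij
    rw [if_neg h]
    exact (mul_eq_zero.mp hij).resolve_left hεm

omit [Fintype n] [DecidableEq n] in
/-- All `D_j ≠ 0` under adaptedness (`t_j ≠ 0`). [folklore] -/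
theorem scale_ne_zero_of_adapted {m : ℝ} {t D ε : n → ℝ} (ht : ∀ j, t j ≠ 0) (hD : ∀ j, m * D j ^ 2 = ε j * t j)
    (hε : ∀ j, ε j = 1 ∨ ε j = -1) (j : n) : D j ≠ 0 := by
  intro h0
  have h2 := hD j
  rw [h0] at h2
  have h3 : ε j * t j = 0 := by rw [← h2]; ring
  rcases mul_eq_zero.mp h3 with h4 | h4
  · rcases hε j with h1 | h1 <;> simp [h1] at h4
  · exact ht j h4

/-- **The Folland unitary matrix is unitary** for a sign-block `k` preserving `diag(t)`, with adapted scaling.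
[cite: Folland1989, Ch. 4 §1, Prop. (4.6) p. 151] -/
theorem follandUnitaryMatrix_mem_unitaryGroup {m : ℝ} (hm : m ≠ 0) {t D ε : n → ℝ} (ht : ∀ j, t j ≠ 0)
    (hD : ∀ j, m * D j ^ 2 = ε j * t j) (hε : ∀ j, ε j = 1 ∨ ε j = -1) (k : GL n ℂ)
    (hform : k ∈ unitaryGroupOfForm (starRingEnd ℂ) ((Matrix.diagonal t).map Complex.ofRealHom))
    (hblock : IsSignBlock ε (k : Matrix n n ℂ)) :
    follandUnitaryMatrix D ε (k : Matrix n n ℂ) ∈ Matrix.unitaryGroup n ℂ := by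
  have hD0 := scale_ne_zero_of_adapted ht hD hε
  rw [Matrix.mem_unitaryGroup_iff', Matrix.star_eq_conjTranspose]
  ext i j
  rw [Matrix.mul_apply, Matrix.one_apply]
  -- each summand, rewritten through the sign of the column `i`
  have hterm : ∀ l, (follandUnitaryMatrix D ε (k : Matrix n n ℂ))ᴴ i l * follandUnitaryMatrix D ε (k : Matrix n n ℂ) l j
      = ((1 / (D i * D j) : ℝ) : ℂ) *
        signConj ε i (conj ((k : Matrix n n ℂ) l i) * ((D l ^ 2 : ℝ) : ℂ) * (k : Matrix n n ℂ) l j) := by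
    intro l
    rw [Matrix.conjTranspose_apply, follandUnitaryMatrix_apply, follandUnitaryMatrix_apply, star_mul',
      Complex.star_def, Complex.conj_ofReal]
    by_cases h0 : (k : Matrix n n ℂ) l i = 0
    · simp [h0]
    · have hεl : ε l = ε i := hblock.eq_of_ne_zero h0
      rw [signConj_congr hεl, signConj_congr hεl, signConj_mul, signConj_mul, signConj_ofReal,
        ← conj_signConj]
      have hDl := hD0 l; have hDi := hD0 i; have hDj := hD0 j
      push_cast
      field_simp
  simp only [hterm, ← Finset.mul_sum, ← signConj_sum]
  rw [sum_conj_mul_sq_mul_eq hm hD hε k hform hblock i j]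
  split_ifs with h
  · subst h
    rw [signConj_ofReal]
    have hDi : (D i : ℂ) ≠ 0 := Complex.ofReal_ne_zero.mpr (hD0 i)
    push_cast
    field_simp
  · rw [signConj_zero, mul_zero]

/-- **The Folland unitary** `follandUnitary … k ∈ U(n)` of a sign-block `k ∈ U(diag t)` for the adapted scaling `D`.
[cite: Folland1989, Ch. 4 §1, Prop. (4.6) p. 151] -/
def follandUnitary {m : ℝ} (hm : m ≠ 0) {t D ε : n → ℝ} (ht : ∀ j, t j ≠ 0)
    (hD : ∀ j, m * D j ^ 2 = ε j * t j) (hε : ∀ j, ε j = 1 ∨ ε j = -1) (k : GL n ℂ)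
    (hform : k ∈ unitaryGroupOfForm (starRingEnd ℂ) ((Matrix.diagonal t).map Complex.ofRealHom))
    (hblock : IsSignBlock ε (k : Matrix n n ℂ)) : Matrix.unitaryGroup n ℂ :=
  ⟨follandUnitaryMatrix D ε (k : Matrix n n ℂ), follandUnitaryMatrix_mem_unitaryGroup hm ht hD hε k hform hblock⟩

/-- The matrix of `follandUnitary`. [folklore] -/
@[simp] theorem coe_follandUnitary {m : ℝ} (hm : m ≠ 0) {t D ε : n → ℝ} (ht : ∀ j, t j ≠ 0)
    (hD : ∀ j, m * D j ^ 2 = ε j * t j) (hε : ∀ j, ε j = 1 ∨ ε j = -1) (k : GL n ℂ)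
    (hform : k ∈ unitaryGroupOfForm (starRingEnd ℂ) ((Matrix.diagonal t).map Complex.ofRealHom))
    (hblock : IsSignBlock ε (k : Matrix n n ℂ)) :
    ((follandUnitary hm ht hD hε k hform hblock : Matrix.unitaryGroup n ℂ) : Matrix n n ℂ) =
      follandUnitaryMatrix D ε (k : Matrix n n ℂ) := rfl

end Unitary

/-! ## §2 The main computation: `k` in adapted Folland coordinates is `realify (follandUnitary k)` -/

section Folland

variable {n : Type*} [Fintype n] [DecidableEq n]

omit [DecidableEq n] in
/-- **The Folland unitary on adapted phase-space vectors**: for a sign-block `k`,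
`(follandUnitaryMatrix D ε k) · (D_j · signConj ε j (x_j))_j = (D_i · signConj ε i ((k x)_i))_i`. [folklore] -/
theorem follandUnitaryMatrix_mulVec_scaled (D ε : n → ℝ) (hD0 : ∀ j, D j ≠ 0) (k : Matrix n n ℂ)
    (hblock : IsSignBlock ε k) (x : n → ℂ) (i : n) :
    (follandUnitaryMatrix D ε k *ᵥ fun j => (D j : ℂ) * signConj ε j (x j)) i =
      (D i : ℂ) * signConj ε i ((k *ᵥ x) i) := by
  simp only [Matrix.mulVec, dotProduct, follandUnitaryMatrix_apply, signConj_sum, Finset.mul_sum]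
  refine Finset.sum_congr rfl fun j _ => ?_
  by_cases h0 : k i j = 0
  · simp [h0]
  · rw [signConj_congr (hblock.eq_of_ne_zero h0).symm (x j), signConj_mul]
    have hDj : (D j : ℂ) ≠ 0 := Complex.ofReal_ne_zero.mpr (hD0 j)
    push_cast
    field_simp

variable {Ψ : (ℝ × ℝ) ≃+ ℂ} {δ' : ℂ} {d : ℝ} (h : IsQuadraticCoordinates Complex.ofRealHom Ψ δ' d)
include h

omit [Fintype n] [DecidableEq n] in
/-- In purely imaginary coordinates `Ψ (a, b) = a + i m b` (`m = im δ'`): real part `a`, imaginary part `m b`.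
[folklore] -/
theorem quadratic_apply_re_im (hre : δ'.re = 0) (a b : ℝ) :
    (Ψ (a, b)).re = a ∧ (Ψ (a, b)).im = δ'.im * b := by
  rw [h.apply]
  constructor
  · simp [hre]
  · simp [hre]; ring

omit [Fintype n] [DecidableEq n] in
/-- **`phasePt` of the adapted Folland scaling**: `p_j + i q_j = D_j · signConj ε j (Ψ (a_j, b_j))` under
`im δ' · D_j² = ε_j t_j`, `ε_j = ±1` (`ζ_j = D_j x̄_j` on the `+1` coordinates, `D_j x_j` on the `−1` ones).
[cite: Folland1989, Ch. 4 §1, Prop. (4.6) p. 151] -/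
theorem phasePt_follandScale (hre : δ'.re = 0) {t D ε : n → ℝ} (hD : ∀ j, δ'.im * D j ^ 2 = ε j * t j)
    (hε : ∀ j, ε j = 1 ∨ ε j = -1) (hD0 : ∀ j, D j ≠ 0) (a b : n → ℝ) (j : n) :
    phasePt (follandScale D t (a, b)).1 (follandScale D t (a, b)).2 j =
      (D j : ℂ) * signConj ε j (Ψ (a j, b j)) := by
  obtain ⟨hr, hi⟩ := quadratic_apply_re_im h hre (a j) (b j)
  have htj : t j = ε j * (δ'.im * D j ^ 2) := by
    rw [hD j]; rcases hε j with h1 | h1 <;> rw [h1] <;> ring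
  apply Complex.ext
  · simp only [phasePt_apply, follandScale_apply, Complex.add_re, Complex.ofReal_re, Complex.mul_re,
      Complex.I_re, Complex.I_im, Complex.ofReal_im, mul_zero, zero_mul, sub_zero, add_zero,
      re_signConj, hr]
  · simp only [phasePt_apply, follandScale_apply, Complex.add_im, Complex.ofReal_im, Complex.mul_im,
      Complex.I_re, Complex.I_im, Complex.ofReal_re, mul_zero, mul_one, zero_add, add_zero,
      im_signConj (hε j), hi, htj]
    have hDj := hD0 j
    field_simp
    rcases hε j with h1 | h1 <;> rw [h1] <;> ring

/-- **The maximal compact of `U(T)` in adapted Folland coordinates.**  For a real diagonal Gram matrix `T = diag(t_j)`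
(`t_j ≠ 0`), a scaling `D` ADAPTED to `T` and to the purely imaginary coordinates (`im δ' · D_j² = ε_j t_j`,
`ε_j = ±1`) and `k ∈ GLₙ(ℂ)` preserving `diag(t)` and SIGN-BLOCK for `ε`, the action of `k` reads, in the coordinates
`(p, q) = (D a, -D⁻¹ T b)`, as the phase-space map of the unitary `follandUnitary k ∈ U(n)`:
`follandScale (resAut k (a, b)) = realify (follandUnitary k) (follandScale (a, b))`.
[cite: Folland1989, Ch. 4 §1, Prop. (4.6) p. 151] -/
theorem follandScale_resAut_eq_realify (hre : δ'.re = 0) {t D ε : n → ℝ} (ht : ∀ j, t j ≠ 0)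
    (hD : ∀ j, δ'.im * D j ^ 2 = ε j * t j) (hε : ∀ j, ε j = 1 ∨ ε j = -1) (k : GL n ℂ)
    (hform : k ∈ unitaryGroupOfForm (starRingEnd ℂ) ((Matrix.diagonal t).map Complex.ofRealHom))
    (hblock : IsSignBlock ε (k : Matrix n n ℂ)) (ab : (n → ℝ) × (n → ℝ)) :
    follandScale D t (h.resAut n k ab) =
      realify (follandUnitary (im_ne_zero_of_isQuadraticCoordinates h hre) ht hD hε k hform hblock)
        (follandScale D t ab) := by
  have him := im_ne_zero_of_isQuadraticCoordinates h hre
  have hD0 := scale_ne_zero_of_adapted ht hD hε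
  -- write `ab = reIm x`
  set x : n → ℂ := (QuadraticCoordinates.reIm Ψ n).symm ab with hx
  have hab : ab = QuadraticCoordinates.reIm Ψ n x := ((QuadraticCoordinates.reIm Ψ n).apply_symm_apply ab).symm
  have hxj : ∀ j, Ψ (ab.1 j, ab.2 j) = x j := fun j => rfl
  -- the phase-space vector of the right-hand side
  have hpt : phasePt (follandScale D t ab).1 (follandScale D t ab).2 = fun j => (D j : ℂ) * signConj ε j (x j) := by
    funext j
    rw [← hxj j]
    exact phasePt_follandScale h hre hD hε hD0 ab.1 ab.2 j
  have hU : ((follandUnitary him ht hD hε k hform hblock : Matrix.unitaryGroup n ℂ) : Matrix n n ℂ) *ᵥ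
      phasePt (follandScale D t ab).1 (follandScale D t ab).2 = fun i =>
        (D i : ℂ) * signConj ε i (((k : Matrix n n ℂ) *ᵥ x) i) := by
    funext i
    rw [hpt, coe_follandUnitary]
    exact follandUnitaryMatrix_mulVec_scaled D ε hD0 _ hblock x i
  -- the left-hand side through `reIm`
  have hres : h.resAut n k ab = QuadraticCoordinates.reIm Ψ n ((k : Matrix n n ℂ) *ᵥ x) := by
    rw [← h.resAut_reIm, ← hab]
  rw [hres]
  have htj : ∀ j, t j = ε j * (δ'.im * D j ^ 2) := fun j => by
    rw [hD j]; rcases hε j with h1 | h1 <;> rw [h1] <;> ring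
  refine Prod.ext (funext fun i => ?_) (funext fun i => ?_)
  · change (D i) * QuadraticCoordinates.re Ψ (((k : Matrix n n ℂ) *ᵥ x) i) =
      ((((follandUnitary him ht hD hε k hform hblock : Matrix.unitaryGroup n ℂ) : Matrix n n ℂ) *ᵥ
        phasePt (follandScale D t ab).1 (follandScale D t ab).2) i).re
    rw [re_eq_re h hre, hU]
    simp only [Complex.re_ofReal_mul, re_signConj]
  · change -(t i / D i) * QuadraticCoordinates.im Ψ (((k : Matrix n n ℂ) *ᵥ x) i) =
      ((((follandUnitary him ht hD hε k hform hblock : Matrix.unitaryGroup n ℂ) : Matrix n n ℂ) *ᵥ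
        phasePt (follandScale D t ab).1 (follandScale D t ab).2) i).im
    rw [im_eq_im_div h hre, hU]
    simp only [Complex.im_ofReal_mul, im_signConj (hε i), htj i]
    have hDi := hD0 i
    field_simp

end Folland

/-! ## §2b Consistency with STEP 1: on the torus the Folland unitary is `diagHom (torusPt (ε · θ))` -/

section TorusCheck

variable {n : Type*} [Fintype n] [DecidableEq n]

/-- The compact diagonal torus is sign-block for every sign vector. [folklore] -/
theorem isSignBlock_torusGL (ε : n → ℝ) (θ : n → ℝ) : IsSignBlock ε ((torusGL θ : GL n ℂ) : Matrix n n ℂ) := by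
  rw [coe_torusGL]; exact isSignBlock_diagonal ε _

/-- **On the torus `diag(e^{iθ})` the Folland unitary is STEP 1's rotation** `diagHom (torusPt (ε · θ))`
(`torusPt φ = (e^{-iφ_j})_j`): `signConj ε j (e^{iθ_j}) = e^{-iε_jθ_j}`. [cite: Folland1989, Ch. 4 §1, Prop. (4.6) p. 151] -/
theorem follandUnitary_torusGL {m : ℝ} (hm : m ≠ 0) {t D ε : n → ℝ} (ht : ∀ j, t j ≠ 0)
    (hD : ∀ j, m * D j ^ 2 = ε j * t j) (hε : ∀ j, ε j = 1 ∨ ε j = -1) (θ : n → ℝ)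
    (hform : (torusGL θ : GL n ℂ) ∈ unitaryGroupOfForm (starRingEnd ℂ) ((Matrix.diagonal t).map Complex.ofRealHom))
    (hblock : IsSignBlock ε ((torusGL θ : GL n ℂ) : Matrix n n ℂ)) :
    follandUnitary hm ht hD hε (torusGL θ) hform hblock = diagHom (torusPt fun j => ε j * θ j) := by
  apply Subtype.ext
  rw [coe_follandUnitary]
  ext i j
  rw [follandUnitaryMatrix_apply, coe_torusGL, coe_diagHom]
  by_cases hij : i = j
  · subst hij
    rw [Matrix.diagonal_apply_eq, Matrix.diagonal_apply_eq, div_self (scale_ne_zero_of_adapted ht hD hε i),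
      Complex.ofReal_one, one_mul, torusPt, Circle.coe_exp]
    unfold signConj
    rcases hε i with h1 | h1
    · rw [if_pos h1, h1, ← Complex.exp_conj, map_mul, Complex.conj_ofReal, Complex.conj_I]
      push_cast; ring_nf
    · rw [if_neg (by rw [h1]; norm_num), h1]
      push_cast; ring_nf
  · rw [Matrix.diagonal_apply_ne _ hij, Matrix.diagonal_apply_ne _ hij, signConj_zero, mul_zero]

end TorusCheck

/-! ## §3 The adelic form: the place-by-place compact group in the scaled Folland frame -/

section PlaceBlock

variable {ι : Type} [Fintype ι] [DecidableEq ι] {o : Type} [Fintype o] [DecidableEq o]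

/-- **Block-diagonal unitary over a finite family of places**: `placeBlock U ∈ U(ι × o)` with blocks `U v ∈ U(ι)`,
entries `((i, v), (j, v')) ↦ δ_{v v'} (U v)_{i j}` (Mathlib `Matrix.blockDiagonal`). [folklore] -/
def placeBlock (U : o → Matrix.unitaryGroup ι ℂ) : Matrix.unitaryGroup (ι × o) ℂ :=
  ⟨Matrix.blockDiagonal fun v => (U v : Matrix ι ι ℂ), by
    rw [Matrix.mem_unitaryGroup_iff', Matrix.star_eq_conjTranspose, Matrix.blockDiagonal_conjTranspose,
      ← Matrix.blockDiagonal_mul]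
    have h1 : (fun v => (U v : Matrix ι ι ℂ)ᴴ * (U v : Matrix ι ι ℂ)) = 1 := by
      funext v
      have h := Matrix.mem_unitaryGroup_iff'.mp (U v).2
      rwa [Matrix.star_eq_conjTranspose] at h
    rw [h1, Matrix.blockDiagonal_one]⟩

/-- The matrix of `placeBlock U`. [folklore] -/
@[simp] theorem coe_placeBlock (U : o → Matrix.unitaryGroup ι ℂ) :
    ((placeBlock U : Matrix.unitaryGroup (ι × o) ℂ) : Matrix (ι × o) (ι × o) ℂ) =
      Matrix.blockDiagonal fun v => (U v : Matrix ι ι ℂ) := rfl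

omit [DecidableEq ι] in
/-- `blockDiagonal M` acts slice by slice: `(blockDiagonal M · x) (i, v) = (M v · x(·, v)) i`. [folklore] -/
theorem blockDiagonal_mulVec_apply (M : o → Matrix ι ι ℂ) (x : ι × o → ℂ) (i : ι) (v : o) :
    (Matrix.blockDiagonal M *ᵥ x) (i, v) = (M v *ᵥ fun j => x (j, v)) i := by
  simp only [Matrix.mulVec, dotProduct, Fintype.sum_prod_type, Matrix.blockDiagonal_apply', ite_mul, zero_mul,
    Finset.sum_ite_eq, Finset.mem_univ, if_true]

/-- **`realify (placeBlock U)` acts slice by slice**, first component. [folklore] -/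
theorem realify_placeBlock_fst (U : o → Matrix.unitaryGroup ι ℂ) (pq : (ι × o → ℝ) × (ι × o → ℝ)) (i : ι) (v : o) :
    (realify (placeBlock U) pq).1 (i, v) = (realify (U v) (fun j => pq.1 (j, v), fun j => pq.2 (j, v))).1 i := by
  simp only [realify, coe_placeBlock, blockDiagonal_mulVec_apply]
  rfl

/-- **`realify (placeBlock U)` acts slice by slice**, second component. [folklore] -/
theorem realify_placeBlock_snd (U : o → Matrix.unitaryGroup ι ℂ) (pq : (ι × o → ℝ) × (ι × o → ℝ)) (i : ι) (v : o) :
    (realify (placeBlock U) pq).2 (i, v) = (realify (U v) (fun j => pq.1 (j, v), fun j => pq.2 (j, v))).2 i := by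
  simp only [realify, coe_placeBlock, blockDiagonal_mulVec_apply]
  rfl

end PlaceBlock

section Adelic

variable {F : Type} [Field F] [NumberField F] {ι : Type} [Fintype ι] [DecidableEq ι] [IsTotallyReal F]

omit [NumberField F] [Fintype ι] [DecidableEq ι] [IsTotallyReal F] in
/-- `σ_v(t₀ j) ≠ 0` for `t₀ j ≠ 0`. [folklore] -/
theorem embedding_apply_ne_zero (t₀ : ι → F) (ht₀ : ∀ j, t₀ j ≠ 0) (v : {v : InfinitePlace F // v.IsReal}) (j : ι) :
    embedding_of_isReal v.2 (t₀ j) ≠ 0 :=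
  (map_ne_zero_iff _ (embedding_of_isReal v.2).injective).mpr (ht₀ j)

/-- **The place-`v` Folland unitary** of a place-family `kv : v ↦ k_v ∈ GL_ι(ℂ)` of sign-block matrices preserving
`diag(σ_v t₀)`, for the scaling `D_{·,v}` adapted at `v`. [cite: Folland1989, Ch. 4 §1, Prop. (4.6) p. 151] -/
def placeFollandUnitary (t₀ : ι → F) (ht₀ : ∀ j, t₀ j ≠ 0)
    {Ψ : {v : InfinitePlace F // v.IsReal} → ((ℝ × ℝ) ≃+ ℂ)} {δ' : {v : InfinitePlace F // v.IsReal} → ℂ}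
    {d : {v : InfinitePlace F // v.IsReal} → ℝ}
    (hq : ∀ v, IsQuadraticCoordinates Complex.ofRealHom (Ψ v) (δ' v) (d v)) (hre : ∀ v, (δ' v).re = 0)
    {D ε : ι × {v : InfinitePlace F // v.IsReal} → ℝ}
    (hD : ∀ k, (δ' k.2).im * D k ^ 2 = ε k * embedding_of_isReal k.2.2 (t₀ k.1))
    (hε : ∀ k, ε k = 1 ∨ ε k = -1) (kv : {v : InfinitePlace F // v.IsReal} → GL ι ℂ)
    (hform : ∀ v, kv v ∈ unitaryGroupOfForm (starRingEnd ℂ)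
      ((Matrix.diagonal fun j => embedding_of_isReal v.2 (t₀ j)).map Complex.ofRealHom))
    (hblock : ∀ v, IsSignBlock (fun j => ε (j, v)) ((kv v : GL ι ℂ) : Matrix ι ι ℂ))
    (v : {v : InfinitePlace F // v.IsReal}) : Matrix.unitaryGroup ι ℂ :=
  follandUnitary (im_ne_zero_of_isQuadraticCoordinates (hq v) (hre v)) (embedding_apply_ne_zero t₀ ht₀ v)
    (fun j => hD (j, v)) (fun j => hε (j, v)) (kv v) (hform v) (hblock v)

omit [NumberField F] [IsTotallyReal F] in
/-- The matrix of the place-`v` Folland unitary: entries `(D_{i,v}/D_{j,v}) · signConj ε_{·,v} i ((k_v)_{i j})`. [folklore] -/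
@[simp] theorem coe_placeFollandUnitary (t₀ : ι → F) (ht₀ : ∀ j, t₀ j ≠ 0)
    {Ψ : {v : InfinitePlace F // v.IsReal} → ((ℝ × ℝ) ≃+ ℂ)} {δ' : {v : InfinitePlace F // v.IsReal} → ℂ}
    {d : {v : InfinitePlace F // v.IsReal} → ℝ}
    (hq : ∀ v, IsQuadraticCoordinates Complex.ofRealHom (Ψ v) (δ' v) (d v)) (hre : ∀ v, (δ' v).re = 0)
    {D ε : ι × {v : InfinitePlace F // v.IsReal} → ℝ}
    (hD : ∀ k, (δ' k.2).im * D k ^ 2 = ε k * embedding_of_isReal k.2.2 (t₀ k.1))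
    (hε : ∀ k, ε k = 1 ∨ ε k = -1) (kv : {v : InfinitePlace F // v.IsReal} → GL ι ℂ)
    (hform : ∀ v, kv v ∈ unitaryGroupOfForm (starRingEnd ℂ)
      ((Matrix.diagonal fun j => embedding_of_isReal v.2 (t₀ j)).map Complex.ofRealHom))
    (hblock : ∀ v, IsSignBlock (fun j => ε (j, v)) ((kv v : GL ι ℂ) : Matrix ι ι ℂ))
    (v : {v : InfinitePlace F // v.IsReal}) :
    ((placeFollandUnitary t₀ ht₀ hq hre hD hε kv hform hblock v : Matrix.unitaryGroup ι ℂ) : Matrix ι ι ℂ) =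
      follandUnitaryMatrix (fun j => D (j, v)) (fun j => ε (j, v)) ((kv v : GL ι ℂ) : Matrix ι ι ℂ) := rfl

/-- **STEP 2 for the maximal compact (abstract form).**  Let `T = diag(t₀) ⊗ 1` (`t₀ j ≠ 0`), let `g ∈ Sp(W_𝔸)`
act on archimedean pairs PLACE BY PLACE as `resAut (k_v)` in purely imaginary quadratic coordinates `(Ψ_v, δ'_v)`
(hypothesis `hg`), each `k_v` preserving `diag(σ_v t₀)` and sign-block for `ε_{·,v}`, and let the scaling be adapted,
`im δ'_v · D_{j,v}² = ε_{j,v} · σ_v(t₀ j)`, `ε = ±1`.  Then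
`archFolland T e_D (archAct T g (a, w)) = realify (placeBlock (placeFollandUnitary …)) (archFolland T e_D (a, w))`:
in the scaled Folland frame `g` is the block-diagonal unitary with blocks the Folland unitaries of the `k_v`.
[cite: Folland1989, Ch. 4 §1, Prop. (4.6) p. 151] -/
theorem archFolland_archAct_compact (t₀ : ι → F) (ht₀ : ∀ j, t₀ j ≠ 0) {T : Matrix ι ι (AdeleRing (𝓞 F) F)}
    (hT : T = (Matrix.diagonal t₀).map (algebraMap F (AdeleRing (𝓞 F) F)))
    {Ψ : {v : InfinitePlace F // v.IsReal} → ((ℝ × ℝ) ≃+ ℂ)} {δ' : {v : InfinitePlace F // v.IsReal} → ℂ}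
    {d : {v : InfinitePlace F // v.IsReal} → ℝ}
    (hq : ∀ v, IsQuadraticCoordinates Complex.ofRealHom (Ψ v) (δ' v) (d v)) (hre : ∀ v, (δ' v).re = 0)
    {D ε : ι × {v : InfinitePlace F // v.IsReal} → ℝ} (hD0 : ∀ k, D k ≠ 0)
    (hD : ∀ k, (δ' k.2).im * D k ^ 2 = ε k * embedding_of_isReal k.2.2 (t₀ k.1))
    (hε : ∀ k, ε k = 1 ∨ ε k = -1)
    (g : symplecticGroup (polar (adelicForm F ι T))) (kv : {v : InfinitePlace F // v.IsReal} → GL ι ℂ)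
    (hform : ∀ v, kv v ∈ unitaryGroupOfForm (starRingEnd ℂ)
      ((Matrix.diagonal fun j => embedding_of_isReal v.2 (t₀ j)).map Complex.ofRealHom))
    (hblock : ∀ v, IsSignBlock (fun j => ε (j, v)) ((kv v : GL ι ℂ) : Matrix ι ι ℂ))
    (hg : ∀ (a w : ι → mixedSpace F) (v : {v : InfinitePlace F // v.IsReal}),
      (placeVec F ι v (archAct T g (a, w)).1, placeVec F ι v (archAct T g (a, w)).2) =
        (hq v).resAut ι (kv v) (placeVec F ι v a, placeVec F ι v w))
    (a w : ι → mixedSpace F) :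
    archFolland T (scaledFrame F ι D hD0) (archAct T g (a, w)) =
      realify (placeBlock (placeFollandUnitary t₀ ht₀ hq hre hD hε kv hform hblock))
        (archFolland T (scaledFrame F ι D hD0) (a, w)) := by
  have hplace : ∀ v : {v : InfinitePlace F // v.IsReal},
      ((fun j => (archFolland T (scaledFrame F ι D hD0) (archAct T g (a, w))).1 (j, v)),
        (fun j => (archFolland T (scaledFrame F ι D hD0) (archAct T g (a, w))).2 (j, v))) =
      realify (placeFollandUnitary t₀ ht₀ hq hre hD hε kv hform hblock v)
        ((fun j => (archFolland T (scaledFrame F ι D hD0) (a, w)).1 (j, v)),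
          (fun j => (archFolland T (scaledFrame F ι D hD0) (a, w)).2 (j, v))) := by
    intro v
    rw [show archAct T g (a, w) = ((archAct T g (a, w)).1, (archAct T g (a, w)).2) from rfl,
      archFolland_scaledFrame t₀ hT, archFolland_scaledFrame t₀ hT, hg a w v]
    exact follandScale_resAut_eq_realify (hq v) (hre v) (embedding_apply_ne_zero t₀ ht₀ v) (fun j => hD (j, v))
      (fun j => hε (j, v)) (kv v) (hform v) (hblock v) _
  refine Prod.ext (funext fun k => ?_) (funext fun k => ?_)
  · obtain ⟨j, v⟩ := k
    rw [realify_placeBlock_fst]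
    exact congrArg (fun pq : (ι → ℝ) × (ι → ℝ) => pq.1 j) (hplace v)
  · obtain ⟨j, v⟩ := k
    rw [realify_placeBlock_snd]
    exact congrArg (fun pq : (ι → ℝ) × (ι → ℝ) => pq.2 j) (hplace v)

/-- **STEP 2 for the maximal compact as a phase-space map**: `Ξ ∘ (g·) ∘ Ξ⁻¹ = realify (placeBlock (placeFollandUnitary …))`.
[cite: Folland1989, Ch. 4 §1, Prop. (4.6) p. 151] -/
theorem archPhaseMap_compact (t₀ : ι → F) (ht₀ : ∀ j, t₀ j ≠ 0) {T : Matrix ι ι (AdeleRing (𝓞 F) F)}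
    (hT : T = (Matrix.diagonal t₀).map (algebraMap F (AdeleRing (𝓞 F) F))) (hTu : IsUnit (archMat F ι T))
    {Ψ : {v : InfinitePlace F // v.IsReal} → ((ℝ × ℝ) ≃+ ℂ)} {δ' : {v : InfinitePlace F // v.IsReal} → ℂ}
    {d : {v : InfinitePlace F // v.IsReal} → ℝ}
    (hq : ∀ v, IsQuadraticCoordinates Complex.ofRealHom (Ψ v) (δ' v) (d v)) (hre : ∀ v, (δ' v).re = 0)
    {D ε : ι × {v : InfinitePlace F // v.IsReal} → ℝ} (hD0 : ∀ k, D k ≠ 0)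
    (hD : ∀ k, (δ' k.2).im * D k ^ 2 = ε k * embedding_of_isReal k.2.2 (t₀ k.1))
    (hε : ∀ k, ε k = 1 ∨ ε k = -1)
    (g : symplecticGroup (polar (adelicForm F ι T))) (kv : {v : InfinitePlace F // v.IsReal} → GL ι ℂ)
    (hform : ∀ v, kv v ∈ unitaryGroupOfForm (starRingEnd ℂ)
      ((Matrix.diagonal fun j => embedding_of_isReal v.2 (t₀ j)).map Complex.ofRealHom))
    (hblock : ∀ v, IsSignBlock (fun j => ε (j, v)) ((kv v : GL ι ℂ) : Matrix ι ι ℂ))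
    (hg : ∀ (a w : ι → mixedSpace F) (v : {v : InfinitePlace F // v.IsReal}),
      (placeVec F ι v (archAct T g (a, w)).1, placeVec F ι v (archAct T g (a, w)).2) =
        (hq v).resAut ι (kv v) (placeVec F ι v a, placeVec F ι v w)) :
    archPhaseMap T (scaledFrame F ι D hD0) hTu g =
      realify (placeBlock (placeFollandUnitary t₀ ht₀ hq hre hD hε kv hform hblock)) := by
  funext pq
  obtain ⟨⟨a, w⟩, rfl⟩ := (archFolland_bijective (T := T) (scaledFrame F ι D hD0) hTu).2 pq
  rw [archPhaseMap_archFolland]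
  exact archFolland_archAct_compact t₀ ht₀ hT hq hre hD0 hD hε g kv hform hblock hg a w

end Adelic

/-! ## §4 In the CM currency of `archLocalToSymplectic` (`E/F` CM-type quadratic, the place `wOf v` over `v`) -/

section CM

variable {F : Type} [Field F] [NumberField F] (E : Type) [Field E] [NumberField E] [Algebra F E] (c : E ≃ₐ[F] E)
variable (N : ℕ) [IsTotallyReal F]

omit [IsTotallyReal F] in
/-- Membership in `archLocal E N J (wOf v) = U(σ_w J)(ℂ)` for `J = diag(t₀) ⊗ 1` is preservation of the real
diagonal form `diag(σ_v t₀)`. [cite: MoeglinVignerasWaldspurger1987, Ch. 1 I.17] -/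
theorem mem_unitaryGroupOfForm_of_mem_archLocal (hc : c ≠ 1)
    (wOf : {v : InfinitePlace F // v.IsReal} → {w : InfinitePlace E // w.IsComplex})
    (hw : ∀ v, c • (wOf v).1 = (wOf v).1) (hover : ∀ v, (wOf v).1.comap (algebraMap F E) = v.1)
    (t₀ : Fin N → F) {J : Matrix (Fin N) (Fin N) E} (hJ : J = (Matrix.diagonal t₀).map (algebraMap F E))
    (v : {v : InfinitePlace F // v.IsReal}) (k : UnitaryGroup.archLocal E N J (wOf v)) :
    (k : GL (Fin N) ℂ) ∈ unitaryGroupOfForm (starRingEnd ℂ)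
      ((Matrix.diagonal fun j => embedding_of_isReal v.2 (t₀ j)).map Complex.ofRealHom) := by
  have hk : (k : GL (Fin N) ℂ) ∈ unitaryGroupOfForm (starRingEnd ℂ) (J.map (wOf v).1.embedding) := k.2
  rw [UnitaryGroup.archLocalForm_eq_map F E c N (wOf v) (hw v) hc (Matrix.diagonal t₀) hJ,
    Matrix.diagonal_map (map_zero _)] at hk
  have ht : (fun j => UnitaryGroup.realPlaceMap F E c (wOf v) (hw v) hc (t₀ j)) =
      fun j => embedding_of_isReal v.2 (t₀ j) :=
    funext fun j => realPlaceMap_eq_embedding_of_isReal E c (wOf v) (hw v) hc v (hover v) (t₀ j)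
  rwa [ht] at hk

/-- **STEP 2 for the maximal compact in `archLocalToSymplectic` currency.**  For each real place `v` of `F` let
`wOf v` be a complex place of `E` over `v` fixed by `c ≠ 1`; `δ ∈ E` with `c δ = −δ ≠ 0`, `J = diag(t₀) ⊗ 1`,
`t₀ j ≠ 0`.  If `g ∈ Sp(W_𝔸)` acts on archimedean pairs place by place as `archLocalToSymplectic (wOf v) (k v)` with
`k v ∈ archLocal E N J (wOf v)` SIGN-BLOCK for the canonical sign vector `ε_{j,v} = sgn(im σ_{w(v)}(δ) · σ_{w(v)}(t₀ j))`
(hypotheses `hg`, `hblock`), then in the canonically scaled Folland frame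
(`D_{j,v} = √(|σ_{w(v)}(t₀ j)| / |im σ_{w(v)}(δ)|)`) the phase-space map of `g` is the block-diagonal unitary
`realify (placeBlock (placeFollandUnitary …))`. [cite: Folland1989, Ch. 4 §1, Prop. (4.6) p. 151] -/
theorem archPhaseMap_archLocalCompact {δ : E} (hcδ : c δ = -δ) (hδ : δ ≠ 0) (hc : c ≠ 1)
    (wOf : {v : InfinitePlace F // v.IsReal} → {w : InfinitePlace E // w.IsComplex})
    (hw : ∀ v, c • (wOf v).1 = (wOf v).1) (hover : ∀ v, (wOf v).1.comap (algebraMap F E) = v.1)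
    (t₀ : Fin N → F) (ht₀ : ∀ j, t₀ j ≠ 0) (hTs : (Matrix.diagonal t₀).IsSymm)
    {J : Matrix (Fin N) (Fin N) E} (hJ : J = (Matrix.diagonal t₀).map (algebraMap F E))
    {T : Matrix (Fin N) (Fin N) (AdeleRing (𝓞 F) F)}
    (hT : T = (Matrix.diagonal t₀).map (algebraMap F (AdeleRing (𝓞 F) F))) (hTu : IsUnit (archMat F (Fin N) T))
    (g : symplecticGroup (polar (adelicForm F (Fin N) T)))
    (k : ∀ v : {v : InfinitePlace F // v.IsReal}, UnitaryGroup.archLocal E N J (wOf v))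
    (hblock : ∀ v, IsSignBlock
      (fun j => (SignType.sign (((wOf v).1.embedding δ).im * embedding_of_isReal v.2 (t₀ j)) : ℝ))
      ((k v : GL (Fin N) ℂ) : Matrix (Fin N) (Fin N) ℂ))
    (hg : ∀ (a w : Fin N → mixedSpace F) (v : {v : InfinitePlace F // v.IsReal}),
      (placeVec F (Fin N) v (archAct T g (a, w)).1, placeVec F (Fin N) v (archAct T g (a, w)).2) =
        (UnitaryGroup.archLocalToSymplectic F E c N (wOf v) (hw v) hc hcδ hδ hTs hJ (k v)).1
          (placeVec F (Fin N) v a, placeVec F (Fin N) v w)) :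
    archPhaseMap T (scaledFrame F (Fin N)
        (fun k => Real.sqrt (|embedding_of_isReal k.2.2 (t₀ k.1)| / |((wOf k.2).1.embedding δ).im|))
        (sqrt_scale_ne_zero t₀ ht₀
          (fun v => UnitaryGroup.isQuadraticCoordinates_complex ((wOf v).1.embedding δ)
            (UnitaryGroup.re_embedding_delta F E c (wOf v) (hw v) hc hcδ)
            (UnitaryGroup.im_embedding_delta_ne_zero F E c (wOf v) (hw v) hc hcδ hδ))
          (fun v => UnitaryGroup.re_embedding_delta F E c (wOf v) (hw v) hc hcδ))) hTu g =
      realify (placeBlock (placeFollandUnitary t₀ ht₀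
        (fun v => UnitaryGroup.isQuadraticCoordinates_complex ((wOf v).1.embedding δ)
          (UnitaryGroup.re_embedding_delta F E c (wOf v) (hw v) hc hcδ)
          (UnitaryGroup.im_embedding_delta_ne_zero F E c (wOf v) (hw v) hc hcδ hδ))
        (fun v => UnitaryGroup.re_embedding_delta F E c (wOf v) (hw v) hc hcδ)
        (D := fun k => Real.sqrt (|embedding_of_isReal k.2.2 (t₀ k.1)| / |((wOf k.2).1.embedding δ).im|))
        (ε := fun k => (SignType.sign (((wOf k.2).1.embedding δ).im * embedding_of_isReal k.2.2 (t₀ k.1)) : ℝ))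
        (fun k => adapted_sqrt (UnitaryGroup.im_embedding_delta_ne_zero F E c (wOf k.2) (hw k.2) hc hcδ hδ)
          (fun j => embedding_of_isReal k.2.2 (t₀ j)) k.1)
        (fun k => sign_eq_one_or (UnitaryGroup.im_embedding_delta_ne_zero F E c (wOf k.2) (hw k.2) hc hcδ hδ)
          (fun j => embedding_apply_ne_zero t₀ ht₀ k.2 j) k.1)
        (fun v => (k v : GL (Fin N) ℂ))
        (fun v => mem_unitaryGroupOfForm_of_mem_archLocal E c N hc wOf hw hover t₀ hJ v (k v)) hblock)) := by
  refine archPhaseMap_compact t₀ ht₀ hT hTu _ _ _ _ _ g _ _ hblock (fun a w v => ?_)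
  rw [hg a w v]
  rfl

end CM


end Literature.NumberTheory.Weil1964

end
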